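import Literature.NumberTheory.DiophantineGeometry.CatalanMinusArgument
import Literature.NumberTheory.DiophantineGeometry.CatalanMinusAnnihilator
import Literature.NumberTheory.DiophantineGeometry.CatalanStickelbergerElements
import Mathlib.Algebra.Order.Antidiag.FinsuppEquiv
import HarnessLib

/-!
# Mihăilescu's Theorem III for `p, q ≥ 5`: `q < 4p²` (Schoof, Chapter 11)

[Schoof2009, Theorem III] (P. Mihăilescu 2003; J. Number Theory **118** (2006)): for odd primes
`p, q` and non-zero integers with `x^p - y^q = 1` one has `p < 4q²` and `q < 4p²`. This file
proves the main case `p, q ≥ 5` ([Schoof2009, Ch. 11]; the case `3 ∈ {p, q}` is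
[Schoof2009, Theorem IV / Corollary 8.4], treated separately):

* `Catalan.choose_gt_of_le` — **[Schoof2009, Lemma 11.4]**: `C(s+k, k) > (4/3)(s+1)k² + 1` for
  `k ≥ 2`, `s ≥ 6`, `(k, s) ∉ {(2,6),(2,7),(2,8),(3,6)}` (as `4(s+1)k² + 3 < 3 C(s+k,k)`);
* `Catalan.not_four_mul_sq_lt` — for primes `p, q ≥ 5` and a non-zero solution, `¬ 4p² < q`:
  with `m = (p-1)/2`, `s = ⌊3q/(2(p-1)²)⌋`, the `2 C(s+m, m) - 1 ≥ q + 1` elements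
  `θ = ±∑ λ_i e_i` (`λ_i ≥ 0`, `∑ λ_i ≤ s`) of `I = (1-ι)𝒮` are distinct
  (`Catalan.coeffU_linearIndependent`, [Schoof2009, Theorem 9.3]) of size `≤ (3/2) q/(p-1)`
  ([Schoof2009, Proposition 11.3]); each `(x - ζ)^θ` is a `q`-th power `α_θ^q`
  (`Catalan.exists_pow_eq_prod_zpow_coeffU`, [Schoof2009, Proposition 10.1]) with `φ(α_θ)` within
  `‖θ‖/(q(|x|-1))` of a `q`-th root of unity ([Schoof2009, Proposition 11.2]); by the box
  principle two share the root of unity ([Schoof2009, Corollary 11.5]), and their difference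
  contradicts `Catalan.minusArgument` ([Schoof2009, proof of Theorem III]).

Everything is proved; no definitions, no named facts.

## References

* R. Schoof, *Catalan's Conjecture*, Universitext, Springer 2009 [Schoof2009], Chapter 11
  (Proposition 11.3, Lemma 11.4, Corollary 11.5, Theorem III; book pp. 75–80) — held,
  `lit read book:schoof2009-catalan-s-conjecture` (PDF pp. 151–155).
* P. Mihăilescu, *On the class groups of cyclotomic extensions in presence of a solution to
  Catalan's equation*, J. Number Theory **118** (2006), 123–144.
-/

namespace Literature.NumberTheory.DiophantineGeometry

namespace Catalan

open Finset NumberField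

/-! ### Lemma 11.4: a binomial inequality -/

/-- Monotonicity in `s` of [Schoof2009, Lemma 11.4]: if `4(s+1)k² + 3 < 3 C(s+k,k)` then the same
holds for `s + 1`. [cite: Schoof2009, Exercise 11.4 (b)] -/
theorem choose_gt_succ_left {k s : ℕ} (h : 4 * (s + 1) * k ^ 2 + 3 < 3 * (s + k).choose k) :
    4 * (s + 1 + 1) * k ^ 2 + 3 < 3 * (s + 1 + k).choose k := by
  have hid : (s + k).choose k * (s + k + 1) = (s + k + 1).choose k * (s + 1) := by
    have := Nat.choose_mul_succ_eq (s + k) k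
    rwa [show s + k + 1 - k = s + 1 by omega] at this
  have h1 : (4 * (s + 1 + 1) * k ^ 2 + 3) * (s + 1) ≤ (4 * (s + 1) * k ^ 2 + 3) * (s + k + 1) := by
    rcases k with _ | k
    · simp
    · nlinarith [Nat.zero_le (s * k), Nat.zero_le k, Nat.zero_le s]
  have h2 : (4 * (s + 1) * k ^ 2 + 3) * (s + k + 1) < 3 * (s + k + 1).choose k * (s + 1) := by
    calc (4 * (s + 1) * k ^ 2 + 3) * (s + k + 1) < 3 * (s + k).choose k * (s + k + 1) :=
          Nat.mul_lt_mul_of_pos_right h (by omega)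
      _ = 3 * (s + k + 1).choose k * (s + 1) := by rw [mul_assoc, hid, ← mul_assoc]
  rw [show s + 1 + k = s + k + 1 by ring]
  exact Nat.lt_of_mul_lt_mul_right (h1.trans_lt h2)

/-- Monotonicity in `k` of [Schoof2009, Lemma 11.4] (for `s ≥ 6`, `k ≥ 1`).
[cite: Schoof2009, Exercise 11.4 (b)] -/
theorem choose_gt_succ_right {k s : ℕ} (hk : 1 ≤ k) (hs : 6 ≤ s)
    (h : 4 * (s + 1) * k ^ 2 + 3 < 3 * (s + k).choose k) :
    4 * (s + 1) * (k + 1) ^ 2 + 3 < 3 * (s + (k + 1)).choose (k + 1) := by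
  have hid : (s + k + 1) * (s + k).choose k = (s + k + 1).choose (k + 1) * (k + 1) :=
    Nat.add_one_mul_choose_eq (s + k) k
  have h1 : (4 * (s + 1) * (k + 1) ^ 2 + 3) * (k + 1) ≤ (4 * (s + 1) * k ^ 2 + 3) * (s + k + 1) := by
    -- difference `= 4(s+1)(k² s - 2k² - 3k - 1) + 3 s ≥ 0` for `s ≥ 6`, `k ≥ 1`
    have hk2 : 2 * k ^ 2 + 3 * k + 1 ≤ k ^ 2 * s := by nlinarith
    nlinarith [Nat.zero_le (s * (k ^ 2 * s - (2 * k ^ 2 + 3 * k + 1))), Nat.sub_add_cancel hk2]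
  have h2 : (4 * (s + 1) * k ^ 2 + 3) * (s + k + 1) < 3 * (s + k + 1).choose (k + 1) * (k + 1) := by
    calc (4 * (s + 1) * k ^ 2 + 3) * (s + k + 1) < 3 * (s + k).choose k * (s + k + 1) :=
          Nat.mul_lt_mul_of_pos_right h (by omega)
      _ = 3 * (s + k + 1).choose (k + 1) * (k + 1) := by
          rw [mul_assoc, mul_comm ((s + k).choose k), hid, ← mul_assoc]
  rw [show s + (k + 1) = s + k + 1 by ring]
  exact Nat.lt_of_mul_lt_mul_right (h1.trans_lt h2)

/-- **[Schoof2009, Lemma 11.4].** For `k ≥ 2`, `s ≥ 6` and `(k, s)` not among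
`(2,6), (2,7), (2,8), (3,6)`: `C(s+k, k) > (4/3)(s+1)k² + 1`, i.e. `4(s+1)k² + 3 < 3 C(s+k, k)`.
We state the three cases used: `k ≥ 4 ∧ s ≥ 6`, `k = 3 ∧ s ≥ 7`, `k = 2 ∧ s ≥ 9`.
[cite: Schoof2009, Lemma 11.4] -/
theorem choose_gt_of_le {k s : ℕ}
    (hks : (4 ≤ k ∧ 6 ≤ s) ∨ (k = 3 ∧ 7 ≤ s) ∨ (k = 2 ∧ 9 ≤ s)) :
    4 * (s + 1) * k ^ 2 + 3 < 3 * (s + k).choose k := by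
  -- induction in `s` from a base value
  have hmono : ∀ k s₀, 4 * (s₀ + 1) * k ^ 2 + 3 < 3 * (s₀ + k).choose k →
      ∀ s, s₀ ≤ s → 4 * (s + 1) * k ^ 2 + 3 < 3 * (s + k).choose k := by
    intro k s₀ h0 s hs
    induction s, hs using Nat.le_induction with
    | base => exact h0
    | succ s _ ih => exact choose_gt_succ_left ih
  rcases hks with ⟨hk, hs⟩ | ⟨rfl, hs⟩ | ⟨rfl, hs⟩
  · -- base `(4, 6)`: `C(10,4) = 210`, then up in `k` (at `s = 6`... no: first in `k` at `s = 6`, then in `s`)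
    have h46 : 4 * (6 + 1) * 4 ^ 2 + 3 < 3 * (6 + 4).choose 4 := by decide
    have hk' : ∀ k, 4 ≤ k → 4 * (6 + 1) * k ^ 2 + 3 < 3 * (6 + k).choose k := by
      intro k hk
      induction k, hk using Nat.le_induction with
      | base => exact h46
      | succ k hk ih => exact choose_gt_succ_right (by omega) le_rfl ih
    exact hmono k 6 (hk' k hk) s hs
  · have h37 : 4 * (7 + 1) * 3 ^ 2 + 3 < 3 * (7 + 3).choose 3 := by decide
    exact hmono 3 7 h37 s hs
  · have h29 : 4 * (9 + 1) * 2 ^ 2 + 3 < 3 * (9 + 2).choose 2 := by decide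
    exact hmono 2 9 h29 s hs

/-! ### Theorem III for `p, q ≥ 5` -/

/-- **[Schoof2009, Theorem III] for `p, q ≥ 5` (P. Mihăilescu 2003).** If `p, q ≥ 5` are primes
and `x, y` non-zero integers with `x ^ p - y ^ q = 1`, then `q ≤ 4 p²` (hence `q < 4p²`).
Proof: [Schoof2009, Ch. 11] — Proposition 11.3 (`q + 1` small elements `±∑ λ_i e_i` of `I`),
Corollary 11.5 (box principle on the `q`-th roots of unity near `φ((x-ζ)^{θ/q})`) and the norm
argument `Catalan.minusArgument`. [cite: Schoof2009, Theorem III] -/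
theorem not_four_mul_sq_lt {p q : ℕ} [hp : Fact p.Prime] (hq : q.Prime) (hp5 : 5 ≤ p)
    (hq5 : 5 ≤ q) (h4 : 4 * p ^ 2 < q) {x y : ℤ} (hx : x ≠ 0) (hy : y ≠ 0)
    (h : x ^ p - y ^ q = 1) : False := by
  classical
  -- ### the field `K = ℚ(ζ_p)`
  haveI : IsCyclotomicExtension {p} ℚ (CyclotomicField p ℚ) :=
    CyclotomicField.instIsCyclotomicExtensionSingletonNatSetOfCharZero p ℚ
  haveI : NumberField (CyclotomicField p ℚ) := IsCyclotomicExtension.numberField {p} ℚ _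
  have hζ := IsCyclotomicExtension.zeta_spec p ℚ (CyclotomicField p ℚ)
  set ζ : CyclotomicField p ℚ := IsCyclotomicExtension.zeta p ℚ (CyclotomicField p ℚ) with hζdef
  haveI : NeZero p := ⟨hp.out.ne_zero⟩
  -- ### elementary facts
  have hp2 : p ≠ 2 := by omega
  have hpo : Odd p := hp.out.odd_of_ne_two hp2
  have hqo : Odd q := hq.odd_of_ne_two (by omega)
  set m : ℕ := (p - 1) / 2 with hmdef
  have hpm : p = 2 * m + 1 := by obtain ⟨k, hk⟩ := hpo; omega
  have hm2 : 2 ≤ m := by omega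
  have hmp : m ≤ p - 2 := by omega
  have hX0 := cassels_abs_x_ge hp.out hq hpo hqo hx hy h
  have hq4 : (4 : ℤ) ≤ q := by exact_mod_cast (show 4 ≤ q by omega)
  have hx2 : 2 ≤ |x| := by
    have : (4 : ℤ) ^ (p - 1) + 4 ≤ |x| :=
      le_trans (add_le_add (pow_le_pow_left₀ (by norm_num) hq4 _) hq4) hX0
    have h44 : (4 : ℤ) ≤ 4 ^ (p - 1) := le_self_pow₀ (by norm_num) (by omega)
    linarith
  have hXR1 : (1 : ℝ) < |(x : ℝ)| := by
    have : (1 : ℝ) < ((|x| : ℤ) : ℝ) := by exact_mod_cast (show (1 : ℤ) < |x| by linarith)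
    rwa [Int.cast_abs] at this
  -- ### the coefficients `u_{i,a} = M i a - M i (-a)` of `e_i`
  set M : ℕ → (ZMod p)ˣ → ℤ := fun i a =>
    if p ≤ ((i : ZMod p) * a).val + (a : ZMod p).val then 1 else 0 with hMdef
  have hM : ∀ (i : ℕ) (a : (ZMod p)ˣ),
      M i a = if p ≤ ((i : ZMod p) * a).val + (a : ZMod p).val then 1 else 0 := fun _ _ => rfl
  clear_value M
  -- the conjugates `w a = x - ζ^(a⁻¹)` of `x - ζ`
  set w : (ZMod p)ˣ → CyclotomicField p ℚ := fun a =>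
    (x : CyclotomicField p ℚ) - ζ ^ ((a⁻¹ : (ZMod p)ˣ) : ZMod p).val with hwdef
  let φ₀ : CyclotomicField p ℚ →+* ℂ := Classical.choice (inferInstance : Nonempty _)
  have hw0 : ∀ a, w a ≠ 0 := by
    intro a h0
    have h1 : ‖φ₀ (x : CyclotomicField p ℚ)‖ = ‖φ₀ (ζ ^ ((a⁻¹ : (ZMod p)ˣ) : ZMod p).val)‖ := by
      rw [sub_eq_zero.mp h0]
    rw [map_intCast, Complex.norm_intCast, map_pow, norm_pow,
      (hζ.map_of_injective φ₀.injective).norm'_eq_one hp.out.ne_zero, one_pow] at h1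
    have : (2 : ℝ) ≤ 1 := by
      calc (2 : ℝ) ≤ |(x : ℝ)| := by exact_mod_cast hx2
        _ = 1 := h1
    linarith
  -- ### `(x - ζ)^(e_i) = α_i^q` ([Schoof2009, Proposition 10.1])
  have hαex : ∀ i : ℕ, ∃ αi : CyclotomicField p ℚ, i ∈ Icc 1 m →
      (αi ≠ 0 ∧ αi ^ q = ∏ a, w a ^ (M i a - M i (-a))) := by
    intro i
    by_cases hi : i ∈ Icc 1 m
    · obtain ⟨αi, h1, h2⟩ := exists_pow_eq_prod_zpow_coeffU hζ hpo hq hqo hx hy h hM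
        (mem_Icc.mp hi).1 (by have := (mem_Icc.mp hi).2; omega)
      exact ⟨αi, fun _ => ⟨h1, h2⟩⟩
    · exact ⟨1, fun h' => absurd h' hi⟩
  choose α hα using hαex
  have hα0 : ∀ i ∈ Icc 1 m, α i ≠ 0 := fun i hi => (hα i hi).1
  -- ### `θ_c = ∑ c_i e_i` and `A_c = ∏ α_i^(c_i)` for a coefficient vector `c`
  have hF : ∀ c : ℕ → ℤ,
      (∏ i ∈ Icc 1 m, α i ^ c i) ^ q =
        ∏ a, w a ^ (∑ i ∈ Icc 1 m, c i * (M i a - M i (-a))) := by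
    intro c
    rw [← prod_pow]
    have h1 : ∀ i ∈ Icc 1 m, (α i ^ c i) ^ q = ∏ a, w a ^ ((M i a - M i (-a)) * c i) := by
      intro i hi
      rw [← zpow_natCast (α i ^ c i) q, ← zpow_mul, mul_comm, zpow_mul, zpow_natCast, (hα i hi).2,
        ← Finset.prod_zpow]
      exact prod_congr rfl fun a _ => by rw [← zpow_mul]
    rw [prod_congr rfl h1, Finset.prod_comm]
    refine prod_congr rfl fun a _ => ?_
    rw [prod_zpow_eq_zpow_sum _ (hw0 a)]
    congr 1
    exact sum_congr rfl fun i _ => mul_comm _ _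
  have hanti : ∀ (c : ℕ → ℤ) (a : (ZMod p)ˣ),
      (∑ i ∈ Icc 1 m, c i * (M i (-a) - M i (- -a))) =
        -∑ i ∈ Icc 1 m, c i * (M i a - M i (-a)) := by
    intro c a
    rw [← sum_neg_distrib]
    exact sum_congr rfl fun i _ => by rw [coeffU_neg (M := M) i a]; ring
  have hsizeθ : ∀ c : ℕ → ℤ, ∑ a, |∑ i ∈ Icc 1 m, c i * (M i a - M i (-a))| ≤
      ((p - 1 : ℕ) : ℤ) * ∑ i ∈ Icc 1 m, |c i| := by
    intro c
    calc ∑ a, |∑ i ∈ Icc 1 m, c i * (M i a - M i (-a))|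
        ≤ ∑ a, ∑ i ∈ Icc 1 m, |c i| * |M i a - M i (-a)| :=
          sum_le_sum fun a _ => (abs_sum_le_sum_abs _ _).trans (le_of_eq
            (sum_congr rfl fun i _ => abs_mul _ _))
      _ = ∑ i ∈ Icc 1 m, |c i| * ∑ a, |M i a - M i (-a)| := by
          rw [sum_comm]; exact sum_congr rfl fun i _ => by rw [mul_sum]
      _ = ∑ i ∈ Icc 1 m, |c i| * ((p - 1 : ℕ) : ℤ) := by
          refine sum_congr rfl fun i hi => ?_
          rw [sum_abs_coeffU hM (mem_Icc.mp hi).1 (by have := (mem_Icc.mp hi).2; omega)]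
          push_cast [Nat.cast_sub hp.out.one_le]
          ring
      _ = ((p - 1 : ℕ) : ℤ) * ∑ i ∈ Icc 1 m, |c i| := by rw [← sum_mul, mul_comm]
  have hinj : ∀ c c' : ℕ → ℤ,
      (∀ a, ∑ i ∈ Icc 1 m, c i * (M i a - M i (-a)) = ∑ i ∈ Icc 1 m, c' i * (M i a - M i (-a))) →
        ∀ i ∈ Icc 1 m, c i = c' i := by
    intro c c' hcc i hi
    have h0 := coeffU_linearIndependent hM hp5 (c := fun i => c i - c' i) (fun a => by
      have := hcc a
      rw [← sub_eq_zero, ← sum_sub_distrib] at this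
      simpa [sub_mul] using this) i hi
    exact sub_eq_zero.mp h0
  -- ### the index set ([Schoof2009, Proposition 11.3]): `λ ≥ 0`, `∑ λ_i ≤ s`, and signs
  set s : ℕ := 3 * q / (8 * m ^ 2) with hsdef
  have hs8 : s * (8 * m ^ 2) ≤ 3 * q := Nat.div_mul_le_self _ _
  have hs8' : 3 * q < (s + 1) * (8 * m ^ 2) := by
    rw [hsdef]
    exact (Nat.div_lt_iff_lt_mul (by positivity)).mp (Nat.lt_succ_self _)
  set D : Finset (ℕ →₀ ℕ) := (range (m + 1)).finsuppAntidiag s with hDdef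
  have hDcard : D.card = (m + s).choose s := by
    rw [hDdef, Finset.card_finsuppAntidiag_nat_eq_choose, card_range, Nat.add_right_comm,
      Nat.add_sub_cancel]
  have hmemD : ∀ f : ℕ →₀ ℕ, f ∈ D ↔ (range (m + 1)).sum f = s ∧ f.support ⊆ range (m + 1) :=
    fun f => by rw [hDdef, Finset.mem_finsuppAntidiag]
  -- the vector `λ` attached to `(f, b)`: `λ_i = ± f i` on `[1, m]`
  set cvec : (ℕ →₀ ℕ) × Bool → ℕ → ℤ := fun j i => if j.2 then (j.1 i : ℤ) else -(j.1 i : ℤ)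
    with hcvec
  have hcvec_abs : ∀ j i, |cvec j i| = j.1 i := by
    intro j i
    simp only [hcvec]
    split_ifs <;> simp
  have hsumD : ∀ f ∈ D, ∑ i ∈ Icc 1 m, (f i : ℤ) ≤ s := by
    intro f hf
    have h1 := ((hmemD f).mp hf).1
    have h2 : (range (m + 1)).sum f = f 0 + ∑ i ∈ Icc 1 m, f i := by
      rw [Finset.range_eq_Ico, Finset.sum_eq_sum_Ico_succ_bot (by omega),
        show Ico 1 (m + 1) = Icc 1 m by ext i; simp only [mem_Ico, mem_Icc]; omega]
    have h3 : (∑ i ∈ Icc 1 m, f i : ℕ) ≤ s := by omega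
    exact_mod_cast h3
  set f₀ : ℕ →₀ ℕ := Finsupp.single 0 s with hf₀def
  have hf₀D : f₀ ∈ D := by
    rw [hmemD]
    constructor
    · rw [hf₀def, Finset.sum_eq_single_of_mem 0 (by simp) (fun b _ hb => by
        rw [Finsupp.single_apply, if_neg (Ne.symm hb)])]
      simp
    · rw [hf₀def]
      exact (Finsupp.support_single_subset).trans (by simp)
  -- two distinct indices give distinct `λ` unless they are `(f₀, ±)`
  have hext : ∀ f ∈ D, ∀ f' ∈ D, (∀ i ∈ Icc 1 m, f i = f' i) → f = f' := by
    intro f hf f' hf' heq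
    have hfs := ((hmemD f).mp hf)
    have hfs' := ((hmemD f').mp hf')
    ext i
    by_cases hi : i ∈ range (m + 1)
    · rcases Nat.eq_zero_or_pos i with rfl | hipos
      · have h2 : ∀ g : ℕ →₀ ℕ, (range (m + 1)).sum g = g 0 + ∑ i ∈ Icc 1 m, g i := fun g => by
          rw [Finset.range_eq_Ico, Finset.sum_eq_sum_Ico_succ_bot (by omega),
            show Ico 1 (m + 1) = Icc 1 m by ext i; simp only [mem_Ico, mem_Icc]; omega]
        have e1 := h2 f
        have e2 := h2 f'
        rw [hfs.1] at e1
        rw [hfs'.1] at e2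
        have e3 : ∑ i ∈ Icc 1 m, f i = ∑ i ∈ Icc 1 m, f' i := sum_congr rfl heq
        omega
      · exact heq i (mem_Icc.mpr ⟨hipos, by have := mem_range.mp hi; omega⟩)
    · have h1 : i ∉ f.support := fun hh => hi (hfs.2 hh)
      have h2 : i ∉ f'.support := fun hh => hi (hfs'.2 hh)
      rw [Finsupp.notMem_support_iff] at h1 h2
      rw [h1, h2]
  set J : Finset ((ℕ →₀ ℕ) × Bool) := (D ×ˢ Finset.univ).erase (f₀, false) with hJdef
  have hJinj : ∀ j ∈ J, ∀ j' ∈ J, (∀ i ∈ Icc 1 m, cvec j i = cvec j' i) → j = j' := by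
    intro j hj j' hj' heq
    rw [hJdef, mem_erase, mem_product] at hj hj'
    obtain ⟨f, b⟩ := j
    obtain ⟨f', b'⟩ := j'
    simp only at hj hj' heq ⊢
    by_cases hbb : b = b'
    · subst hbb
      have : f = f' := hext f hj.2.1 f' hj'.2.1 fun i hi => by
        have := heq i hi
        simp only [hcvec] at this
        split_ifs at this <;> simpa using this
      rw [this]
    · -- opposite signs: `f i = -f' i`, so both vanish on `[1, m]`, so `f = f' = f₀`
      have hzero : ∀ i ∈ Icc 1 m, f i = 0 ∧ f' i = 0 := by
        intro i hi
        have := heq i hi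
        simp only [hcvec] at this
        rcases b with _ | _ <;> rcases b' with _ | _ <;> simp at hbb <;> simp at this <;> omega
      have hf : f = f₀ := hext f hj.2.1 f₀ hf₀D fun i hi => by
        rw [(hzero i hi).1, hf₀def, Finsupp.single_apply, if_neg (by rw [mem_Icc] at hi; omega)]
      have hf' : f' = f₀ := hext f' hj'.2.1 f₀ hf₀D fun i hi => by
        rw [(hzero i hi).2, hf₀def, Finsupp.single_apply, if_neg (by rw [mem_Icc] at hi; omega)]
      subst hf hf'
      rcases b with _ | _ <;> rcases b' with _ | _ <;> simp at hbb hj hj' ⊢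
  -- ### counting: `#J = 2 C(m+s, s) - 1 > q` ([Schoof2009, Proposition 11.3, Lemma 11.4])
  have hJcard : J.card = 2 * (m + s).choose s - 1 := by
    rw [hJdef, card_erase_of_mem (by rw [mem_product]; exact ⟨hf₀D, mem_univ _⟩), card_product,
      hDcard, Finset.card_univ, Fintype.card_bool]
    ring_nf
  have hs_cases : (4 ≤ m ∧ 6 ≤ s) ∨ (m = 3 ∧ 7 ≤ s) ∨ (m = 2 ∧ 9 ≤ s) := by
    have hq' : 4 * (2 * m + 1) ^ 2 < q := by rwa [hpm] at h4
    rcases Nat.lt_or_ge m 4 with hm4 | hm4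
    · interval_cases m
      · right; right
        refine ⟨rfl, ?_⟩
        rw [hsdef, Nat.le_div_iff_mul_le (by norm_num)]
        omega
      · right; left
        refine ⟨rfl, ?_⟩
        rw [hsdef, Nat.le_div_iff_mul_le (by norm_num)]
        omega
    · left
      refine ⟨hm4, ?_⟩
      rw [hsdef, Nat.le_div_iff_mul_le (by positivity)]
      nlinarith
  have hchoose := choose_gt_of_le hs_cases
  have hsymm : (s + m).choose m = (m + s).choose s := by
    rw [add_comm, Nat.choose_symm_add]
  have hqJ : q < J.card := by
    rw [hJcard]
    rw [hsymm] at hchoose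
    set P : ℕ := (s + 1) * m ^ 2 with hPdef
    have h1 : 3 * q < 8 * P := by rw [hPdef]; linarith
    have h3 : 4 * P + 3 < 3 * (m + s).choose s := by rw [hPdef]; linarith
    omega
  -- ### the box principle ([Schoof2009, Corollary 11.5])
  set T : Finset ℂ := (Polynomial.nthRoots q (1 : ℂ)).toFinset with hTdef
  have hTcard : T.card ≤ q :=
    (Multiset.toFinset_card_le _).trans (Polynomial.card_nthRoots q 1)
  have hξex : ∀ j : (ℕ →₀ ℕ) × Bool, ∃ ξ : ℂ, ξ ^ q = 1 ∧
      ‖φ₀ (∏ i ∈ Icc 1 m, α i ^ cvec j i) - ξ‖ ≤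
        (∑ a, |∑ i ∈ Icc 1 m, cvec j i * (M i a - M i (-a))| : ℤ) / (q * (|x| - 1) : ℝ) :=
    fun j => exists_pow_eq_one_norm_sub_le hζ hx2 _ (hanti (cvec j)) hq.ne_zero (hF (cvec j)) φ₀
  choose ξ hξ using hξex
  have hmaps : Set.MapsTo ξ J T := fun j _ => by
    rw [Finset.mem_coe, hTdef, Multiset.mem_toFinset, Polynomial.mem_nthRoots hq.pos]
    exact (hξ j).1
  obtain ⟨j, hj, j', hj', hne, hξeq⟩ :=
    Finset.exists_ne_map_eq_of_card_lt_of_maps_to (hTcard.trans_lt hqJ) hmaps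
  -- ### the difference `θ = θ_j - θ_j'` and `α = A_j / A_j'`
  set c : ℕ → ℤ := fun i => cvec j i - cvec j' i with hcdef
  set θ : (ZMod p)ˣ → ℤ := fun a => ∑ i ∈ Icc 1 m, c i * (M i a - M i (-a)) with hθdef
  have hθlin : ∀ a, θ a = (∑ i ∈ Icc 1 m, cvec j i * (M i a - M i (-a))) -
      ∑ i ∈ Icc 1 m, cvec j' i * (M i a - M i (-a)) := fun a => by
    simp only [hθdef, hcdef, sub_mul, sum_sub_distrib]
  have hθ0 : ∃ a, θ a ≠ 0 := by
    by_contra hall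
    refine hne (hJinj j hj j' hj' (hinj _ _ fun a => ?_))
    have := not_not.mp (not_exists.mp hall a)
    rw [hθlin, sub_eq_zero] at this
    exact this
  have hjD : j.1 ∈ D := (mem_product.mp (mem_of_mem_erase hj)).1
  have hj'D : j'.1 ∈ D := (mem_product.mp (mem_of_mem_erase hj')).1
  have hcsum : ∑ i ∈ Icc 1 m, |c i| ≤ 2 * s := by
    calc ∑ i ∈ Icc 1 m, |c i| ≤ ∑ i ∈ Icc 1 m, (|cvec j i| + |cvec j' i|) :=
          sum_le_sum fun i _ => abs_sub _ _
      _ = ∑ i ∈ Icc 1 m, (j.1 i : ℤ) + ∑ i ∈ Icc 1 m, (j'.1 i : ℤ) := by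
          rw [← sum_add_distrib]
          exact sum_congr rfl fun i _ => by rw [hcvec_abs, hcvec_abs]
      _ ≤ s + s := add_le_add (hsumD _ hjD) (hsumD _ hj'D)
      _ = 2 * s := by ring
  have hpm' : ((p - 1 : ℕ) : ℤ) = 2 * m := by
    rw [Nat.cast_sub hp.out.one_le, hpm]; push_cast; ring
  have hsize : ((p - 1 : ℕ) : ℤ) * ∑ a, |θ a| ≤ 3 * q := by
    have h1 := hsizeθ c
    have h2 : ((p - 1 : ℕ) : ℤ) * ∑ a, |θ a| ≤ ((p - 1 : ℕ) : ℤ) * (((p - 1 : ℕ) : ℤ) * (2 * s)) :=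
      mul_le_mul_of_nonneg_left (h1.trans (mul_le_mul_of_nonneg_left hcsum (by positivity)))
        (by positivity)
    have h3 : ((s * (8 * m ^ 2) : ℕ) : ℤ) ≤ ((3 * q : ℕ) : ℤ) := by exact_mod_cast hs8
    push_cast at h3
    rw [hpm'] at h2 ⊢
    nlinarith
  -- `α = A_j / A_j'` and its `q`-th power
  set Aj : CyclotomicField p ℚ := ∏ i ∈ Icc 1 m, α i ^ cvec j i with hAjdef
  set Aj' : CyclotomicField p ℚ := ∏ i ∈ Icc 1 m, α i ^ cvec j' i with hAj'def
  have hAj'0 : Aj' ≠ 0 := prod_ne_zero_iff.mpr fun i hi => zpow_ne_zero _ (hα0 i hi)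
  have hAc : ∏ i ∈ Icc 1 m, α i ^ c i = Aj / Aj' := by
    rw [hAjdef, hAj'def, ← prod_div_distrib]
    exact prod_congr rfl fun i hi => by rw [hcdef]; simp only; rw [zpow_sub₀ (hα0 i hi)]
  have hαq : (Aj / Aj') ^ q = ∏ a, w a ^ θ a := by rw [← hAc, hF c]
  -- ### `|φ₀(α) - 1| ≤ 3 / ((p-1)(|x|-1))`
  have hnorm1 : ‖φ₀ Aj'‖ = 1 :=
    norm_embedding_eq_one_of_pow_eq hζ hx2 _ (hanti (cvec j')) hq.ne_zero (hF (cvec j')) φ₀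
  have hSZ : ∀ jj : (ℕ →₀ ℕ) × Bool, jj.1 ∈ D →
      (∑ a, |∑ i ∈ Icc 1 m, cvec jj i * (M i a - M i (-a))| : ℤ) ≤ 2 * m * s := by
    intro jj hjj
    have e : ∑ i ∈ Icc 1 m, |cvec jj i| = ∑ i ∈ Icc 1 m, (jj.1 i : ℤ) :=
      sum_congr rfl fun i _ => hcvec_abs jj i
    have h1 := hsizeθ (cvec jj)
    rw [e, hpm'] at h1
    have h2 := hsumD _ hjj
    have hm0 : (0 : ℤ) ≤ 2 * m := by positivity
    have h3 := mul_le_mul_of_nonneg_left h2 hm0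
    linarith only [h1, h3]
  have hSR : ∀ jj : (ℕ →₀ ℕ) × Bool, jj.1 ∈ D →
      ((∑ a, |∑ i ∈ Icc 1 m, cvec jj i * (M i a - M i (-a))| : ℤ) : ℝ) ≤ (2 * m : ℝ) * s := by
    intro jj hjj
    exact (Int.cast_le.mpr (hSZ jj hjj)).trans_eq (by push_cast; ring)
  have hSj := hSR j hjD
  have hSj' := hSR j' hj'D
  have hqX : (0 : ℝ) < q * (|(x : ℝ)| - 1) :=
    mul_pos (by exact_mod_cast hq.pos) (by linarith only [hXR1])
  have hφ : ‖φ₀ (Aj / Aj') - 1‖ ≤ 3 / (((p : ℝ) - 1) * (|(x : ℝ)| - 1)) := by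
    have h1 : ‖φ₀ (Aj / Aj') - 1‖ = ‖φ₀ Aj - φ₀ Aj'‖ := by
      have hne0 : φ₀ Aj' ≠ 0 := by
        intro h0; rw [h0, norm_zero] at hnorm1; exact zero_ne_one hnorm1
      rw [map_div₀, div_sub_one hne0, norm_div, hnorm1, div_one]
    have h2 : ‖φ₀ Aj - φ₀ Aj'‖ ≤ ‖φ₀ Aj - ξ j‖ + ‖φ₀ Aj' - ξ j'‖ := by
      rw [hξeq]
      calc ‖φ₀ Aj - φ₀ Aj'‖ = ‖(φ₀ Aj - ξ j') - (φ₀ Aj' - ξ j')‖ := by ring_nf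
        _ ≤ ‖φ₀ Aj - ξ j'‖ + ‖φ₀ Aj' - ξ j'‖ := norm_sub_le _ _
    have h3 := (hξ j).2
    have h4 := (hξ j').2
    rw [Int.cast_abs] at h3 h4
    have h5 : ‖φ₀ Aj - ξ j‖ + ‖φ₀ Aj' - ξ j'‖ ≤ (2 * m * s + 2 * m * s) / (q * (|(x : ℝ)| - 1)) := by
      rw [add_div]
      exact add_le_add (h3.trans (div_le_div_of_nonneg_right hSj hqX.le))
        (h4.trans (div_le_div_of_nonneg_right hSj' hqX.le))
    have h6 : (2 * m * s + 2 * m * s : ℝ) / (q * (|(x : ℝ)| - 1)) ≤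
        3 / (((p : ℝ) - 1) * (|(x : ℝ)| - 1)) := by
      have hp1 : ((p : ℝ) - 1) = 2 * m := by
        have : (((p - 1 : ℕ) : ℤ) : ℝ) = ((2 * m : ℤ) : ℝ) := by exact_mod_cast hpm'
        push_cast [Nat.cast_sub hp.out.one_le] at this
        linarith
      have hX1 : (0 : ℝ) < |(x : ℝ)| - 1 := by linarith only [hXR1]
      have hm0 : (0 : ℝ) < m := by exact_mod_cast (show 0 < m by omega)
      rw [hp1, div_le_div_iff₀ hqX (mul_pos (mul_pos two_pos hm0) hX1)]
      have h7 : (s : ℝ) * (8 * m ^ 2) ≤ 3 * q := by exact_mod_cast hs8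
      calc (2 * (m : ℝ) * s + 2 * m * s) * (2 * m * (|(x : ℝ)| - 1))
          = ((s : ℝ) * (8 * m ^ 2)) * (|(x : ℝ)| - 1) := by ring
        _ ≤ (3 * q) * (|(x : ℝ)| - 1) := mul_le_mul_of_nonneg_right h7 hX1.le
        _ = 3 * (q * (|(x : ℝ)| - 1)) := by ring
    rw [h1]
    exact h2.trans (h5.trans h6)
  exact minusArgument hζ hq hp5 h4 hx hy h θ (fun a => by simp only [hθdef]; exact hanti c a) hθ0
    hsize hαq φ₀ hφ

end Catalan

end Literature.NumberTheory.DiophantineGeometry
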